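import Summits.QuantumFields.YangMills.Theorems.AllWindowsColdBoxBoxHighLineTiltThirdOrderMuD
import Summits.QuantumFields.YangMills.Theorems.AllWindowsColdBoxBoxHighLineRestrictionSetSlots

/-!
# U5 Steps D–E glue ON THE CUT SET — 13u³′ (`TiltThirdOrder` over `μ_{D′}` for a GENERAL measurable `D′`) and the norm/monotone transfer of tilted
# moments from `μ_{D′}` to the `sfInd`-sizes of the κ-lineage (planner ym-idea-2 g18, `Cruxes/BoxWindowHighSU2213/ASSEMBLY-U5.md` v0.2 §3 (D′)/(E′);
# LINE-20 U5 ⟨stmt-QuantumFields-24336⟩; U5 prep, helper-grade; U5 OPEN)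

Width seat `ym-line-sfw-p2-w2` (g33).  Third companion of ✓`…GaussianNormalFormOnCutSet` (`t = 1`) and ✓`…TiltCovZeroMainCutSet` (`t = 0`).  With
`μ_{D′} := (volume.restrict D′).withDensity (ofReal ∘ gaussWeight β H)` for an ARBITRARY measurable `D′` (fcl-p3 g27's letters, ✓`…RestrictionSetMoments`):

* §1 (ns `…GaussNormalForm`) 13u³′: ★★`abs_tiltCov_sub_sub_tiltCum3_sub_half_tiltCum4_le_muSet` — ✓13u³ (fcl-p3 g27 `…_le_muD`) with `D′` for `smallField H s`:
  `E₀[1 − 1_{D′}] ≤ τ ≤ 1/2`, `|Gᵢ| ≤ B`, `|tiltU β H| ≤ B` ON `D′`, `(∀ t ∈ [0,1], |κ₅,t| ≤ K) ⇒ |Cov₁ − Cov₀ − κ₃,₀ − κ₄,₀/2| ≤ K/6` over `μ_{D′}` (abstract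
  ✓`Tilt.abs_tiltCov_sub_sub_tiltCum3_sub_tiltCum4_le_of_ae` + ✓`GaussRestrict.neZero_muSet/ae_muSet_mem`), and `…_chartPlaqCost` (the cut-set sup bound
  `sup_{D′}|tiltU| ≤ 2` of ✓`TiltSup.exists_forall_abs_tiltU_le_on_cubicCut`, `|c| ≤ 4`);
* §2 (ns `…GaussRestrict`) monotone transfer to the κ-lineage's `sfInd` sizes (over fcl-p3 g27's ✓`…RestrictionSetSlots` norm transfer
  `tiltExp_muSet_le_gaussAvg`): `gaussAvg_indicator_mul_le_of_subset` (`0 ≤ G`, `D′ ⊆ smallField H s` ⇒ `E₀[1_{D′}·G] ≤ E₀[sfInd H s·G]`),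
  ★★`tiltExp_muSet_le_two_mul_exp_mul_gaussAvg_sfInd` (`E₀[1 − 1_{D′}] ≤ τ ≤ 1/2`, `|U| ≤ B` on `D′`, `0 ≤ t` ⇒ `E_t^{μ_{D′}}[G] ≤ 2·e^{2tB}·E₀[sfInd·G]`) — so EVERY
  slot size of ✓13K/✓TiltUMoments/✓TiltCum5Sizes (stated as bounds on `E₀[sfInd·Y]`, `Y ≥ 0`) feeds ✓`Tilt.abs_tiltCum5_le_of_moments` over `μ_{D∖E}` with the factor
  `2e^{2tB}`, `B = 2` (the «κ₅ on the cut set» re-run is then pure bookkeeping).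

Mathlib + tree only (✓TiltThirdOrderMuD, ✓RestrictionSetSlots); no definitions; standard axioms.  HONEST LABEL: plumbing for the (UNSTAFFED) third-order assembly
`landauThirdOrder_of` of the XL stub U5 of a critic-PASSed DRAFT line; U5, ⟨24336⟩, ⟨24004⟩ and the seat's own crux ⟨22884⟩ remain OPEN; route AllWindowsColdBox is
DRAFT; no crux, rung or summit is proved; **the Yang–Mills mass gap is NOT proved by this file; no summit is proved by a line.**
-/

set_option autoImplicit false

noncomputable section

open MeasureTheory Set
open Literature.Probability.LatticeModels (Site)

namespace Summit.QuantumFields.YangMills.Theorems.AllWindowsColdBoxBoxHighLine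

/-! ## §1 13u³′: third order over `μ_{D′}` -/

namespace GaussNormalForm

variable {β : ℝ} {H : ℕ}

/-- ★★ **13u³′ = `TiltThirdOrder` ON A GENERAL MEASURABLE `D′`** (`μ_{D′} := (volume.restrict D′).withDensity (ofReal ∘ gaussWeight β H)`, `U = tiltU β H`
verbatim, UNtruncated): for `β > 0`, `E₀[1 − 1_{D′}] ≤ τ ≤ 1/2`, measurable `G₁, G₂` with `|Gᵢ| ≤ B` everywhere and `|tiltU β H| ≤ B` on `D′`,
`(∀ t ∈ [0,1], |κ₅,t(G₁,G₂; tiltU)| ≤ K) → |Cov₁(G₁,G₂) − Cov₀(G₁,G₂) − κ₃,₀ − κ₄,₀/2| ≤ K/6` over `μ_{D′}`. -/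
theorem abs_tiltCov_sub_sub_tiltCum3_sub_half_tiltCum4_le_muSet (hβ : 0 < β) {D : Set (LandauFree H → E3)} (hD : MeasurableSet D) {τ : ℝ}
    (hτ : gaussAvg β H (fun a => 1 - D.indicator (fun _ => (1 : ℝ)) a) ≤ τ) (hτ2 : τ ≤ 1 / 2) {G₁ G₂ : (LandauFree H → E3) → ℝ}
    (h₁ : Measurable G₁) (h₂ : Measurable G₂) {B : ℝ} (h₁b : ∀ a, |G₁ a| ≤ B) (h₂b : ∀ a, |G₂ a| ≤ B) (hUb : ∀ a ∈ D, |tiltU β H a| ≤ B) {K : ℝ}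
    (hK : ∀ t ∈ Set.Icc (0 : ℝ) 1,
      |Tilt.tiltCum5 (((volume : Measure (LandauFree H → E3)).restrict D).withDensity fun a => ENNReal.ofReal (gaussWeight β H a))
        (tiltU β H) t G₁ G₂| ≤ K) :
    |Tilt.tiltCov (((volume : Measure (LandauFree H → E3)).restrict D).withDensity fun a => ENNReal.ofReal (gaussWeight β H a))
          (tiltU β H) 1 G₁ G₂ -
        Tilt.tiltCov (((volume : Measure (LandauFree H → E3)).restrict D).withDensity fun a => ENNReal.ofReal (gaussWeight β H a))
          (tiltU β H) 0 G₁ G₂ -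
        Tilt.tiltCum3 (((volume : Measure (LandauFree H → E3)).restrict D).withDensity fun a => ENNReal.ofReal (gaussWeight β H a))
          (tiltU β H) 0 G₁ G₂ -
        Tilt.tiltCum4 (((volume : Measure (LandauFree H → E3)).restrict D).withDensity fun a => ENNReal.ofReal (gaussWeight β H a))
          (tiltU β H) 0 G₁ G₂ / 2| ≤ K / 6 := by
  haveI := GaussRestrict.isFiniteMeasure_muSet (H := H) hβ D
  haveI := GaussRestrict.neZero_muSet hβ hD (GaussRestrict.integral_indicator_mul_gaussWeight_pos hβ hD hτ hτ2)
  exact Tilt.abs_tiltCov_sub_sub_tiltCum3_sub_tiltCum4_le_of_ae hD (GaussRestrict.ae_muSet_mem β hD)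
    (measurable_tiltU β H) h₁ h₂ h₁b h₂b hUb hK

/-- ★★ **13u³′ for the plaquette-cost slots on the cut set** (`G₁ = c_x`, `G₂ = c_y`, `|c| ≤ 4`) under the cut-set sup bound `sup_{D′}|tiltU β H| ≤ 2`
(✓`TiltSup.exists_forall_abs_tiltU_le_on_cubicCut`, `λ = ε = 1`). -/
theorem abs_tiltCov_sub_sub_tiltCum3_sub_half_tiltCum4_le_muSet_chartPlaqCost (hβ : 0 < β) {D : Set (LandauFree H → E3)} (hD : MeasurableSet D)
    {τ : ℝ} (hτ : gaussAvg β H (fun a => 1 - D.indicator (fun _ => (1 : ℝ)) a) ≤ τ) (hτ2 : τ ≤ 1 / 2) (hU2 : ∀ a ∈ D, |tiltU β H a| ≤ 2)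
    (x y : Site 4) {K : ℝ}
    (hK : ∀ t ∈ Set.Icc (0 : ℝ) 1,
      |Tilt.tiltCum5 (((volume : Measure (LandauFree H → E3)).restrict D).withDensity fun a => ENNReal.ofReal (gaussWeight β H a))
        (tiltU β H) t (chartPlaqCost H x 1 2) (chartPlaqCost H y 1 2)| ≤ K) :
    |Tilt.tiltCov (((volume : Measure (LandauFree H → E3)).restrict D).withDensity fun a => ENNReal.ofReal (gaussWeight β H a))
          (tiltU β H) 1 (chartPlaqCost H x 1 2) (chartPlaqCost H y 1 2) -
        Tilt.tiltCov (((volume : Measure (LandauFree H → E3)).restrict D).withDensity fun a => ENNReal.ofReal (gaussWeight β H a))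
          (tiltU β H) 0 (chartPlaqCost H x 1 2) (chartPlaqCost H y 1 2) -
        Tilt.tiltCum3 (((volume : Measure (LandauFree H → E3)).restrict D).withDensity fun a => ENNReal.ofReal (gaussWeight β H a))
          (tiltU β H) 0 (chartPlaqCost H x 1 2) (chartPlaqCost H y 1 2) -
        Tilt.tiltCum4 (((volume : Measure (LandauFree H → E3)).restrict D).withDensity fun a => ENNReal.ofReal (gaussWeight β H a))
          (tiltU β H) 0 (chartPlaqCost H x 1 2) (chartPlaqCost H y 1 2) / 2| ≤ K / 6 := by
  have hUb4 : ∀ a ∈ D, |tiltU β H a| ≤ 4 := fun a ha => (hU2 a ha).trans (by norm_num)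
  exact abs_tiltCov_sub_sub_tiltCum3_sub_half_tiltCum4_le_muSet hβ hD hτ hτ2 (EdgeChartGaussian.measurable_chartPlaqCost H x 1 2)
    (EdgeChartGaussian.measurable_chartPlaqCost H y 1 2) (fun a => TiltSup.abs_chartPlaqCost_le_four (H := H) x 1 2 a)
    (fun a => TiltSup.abs_chartPlaqCost_le_four (H := H) y 1 2 a) hUb4 hK

end GaussNormalForm

/-! ## §2 Monotone transfer of tilted moments on the cut set to the `sfInd` sizes of the κ-lineage -/

namespace GaussRestrict

open EdgeChartGaussian (integrable_gaussWeight integral_gaussWeight_pos gaussWeight_pos)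

variable {H : ℕ} {β : ℝ}



/-- For `0 ≤ G` with `G·gaussWeight` integrable and `D′ ⊆ smallField H s` measurable: `E₀[1_{D′}·G] ≤ E₀[sfInd H s · G]`. -/
theorem gaussAvg_indicator_mul_le_of_subset (hβ : 0 < β) {D : Set (LandauFree H → E3)} (hD : MeasurableSet D) {s : ℝ}
    (hsub : D ⊆ smallField H s) {G : (LandauFree H → E3) → ℝ} (hG0 : 0 ≤ G) (hG : Integrable fun a => G a * gaussWeight β H a) :
    gaussAvg β H (fun a => D.indicator (fun _ => (1 : ℝ)) a * G a) ≤ gaussAvg β H (fun a => sfInd H s a * G a) := by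
  have hle : ∀ a, D.indicator (fun _ => (1 : ℝ)) a * G a ≤ sfInd H s a * G a := fun a =>
    mul_le_mul_of_nonneg_right (by
      rw [sfInd_eq_indicator]
      exact indicator_le_indicator_of_subset hsub (fun _ => zero_le_one) a) (hG0 a)
  have hint : ∀ {A : Set (LandauFree H → E3)}, MeasurableSet A →
      Integrable fun a : LandauFree H → E3 => (A.indicator (fun _ => (1 : ℝ)) a * G a) * gaussWeight β H a := fun {A} hA => by
    have h1 : (fun a : LandauFree H → E3 => (A.indicator (fun _ => (1 : ℝ)) a * G a) * gaussWeight β H a) =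
        fun a => A.indicator (fun _ => (1 : ℝ)) a * (G a * gaussWeight β H a) := by
      funext a; ring
    rw [h1]
    exact hG.bdd_mul (measurable_const.indicator hA).aestronglyMeasurable
      (Filter.Eventually.of_forall fun a => by
        rw [Real.norm_eq_abs]
        obtain ⟨h0, h1⟩ := indicator_one_nonneg_le_one A a
        rw [abs_of_nonneg h0]; exact h1)
  have hS := hint (ChartGauss.measurableSet_smallField s)
  rw [← sfInd_eq_indicator] at hS
  exact EdgeChartGaussian.gaussAvg_mono H hβ hle (hint hD) hS

/-- ★★ **Tilted moments on the cut set against the `sfInd` sizes**: `E₀[1 − 1_{D′}] ≤ τ ≤ 1/2`, `D′ ⊆ smallField H s`, `0 ≤ G` measurable with `G·gaussWeight`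
integrable, `|U| ≤ B` on `D′`, `0 ≤ t`:  `E_t^{μ_{D′}}[G] ≤ 2·e^{2tB}·E₀[sfInd H s · G]` (norm transfer, `E₀[1_{D′}] ≥ 1/2`, monotonicity). -/
theorem tiltExp_muSet_le_two_mul_exp_mul_gaussAvg_sfInd (hβ : 0 < β) {D : Set (LandauFree H → E3)} (hD : MeasurableSet D) {τ : ℝ}
    (hτ : gaussAvg β H (fun a => 1 - D.indicator (fun _ => (1 : ℝ)) a) ≤ τ) (hτ2 : τ ≤ 1 / 2) {s : ℝ} (hsub : D ⊆ smallField H s)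
    {U G : (LandauFree H → E3) → ℝ} {B t : ℝ} (ht : 0 ≤ t) (hU : Measurable U) (hUb : ∀ a ∈ D, |U a| ≤ B) (hG0 : 0 ≤ G)
    (hG : Integrable fun a => G a * gaussWeight β H a) :
    Tilt.tiltExp (((volume : Measure (LandauFree H → E3)).restrict D).withDensity fun a => ENNReal.ofReal (gaussWeight β H a)) U t G ≤
      2 * Real.exp (2 * t * B) * gaussAvg β H (fun a => sfInd H s a * G a) := by
  have hpos := integral_indicator_mul_gaussWeight_pos hβ hD hτ hτ2
  have hhalf := half_le_gaussAvg_indicator hβ hD hτ hτ2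
  have h1 := tiltExp_muSet_le_gaussAvg hβ hD hpos ht hU hUb hG0 hG
  have h2 := gaussAvg_indicator_mul_le_of_subset hβ hD hsub hG0 hG
  have hE0 : 0 ≤ gaussAvg β H (fun a => D.indicator (fun _ => (1 : ℝ)) a * G a) :=
    EdgeChartGaussian.gaussAvg_nonneg H hβ fun a => mul_nonneg (indicator_one_nonneg_le_one D a).1 (hG0 a)
  have hexp : 0 ≤ Real.exp (2 * t * B) := (Real.exp_pos _).le
  have hden : 0 < gaussAvg β H (D.indicator fun _ => (1 : ℝ)) := by linarith
  refine h1.trans ?_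
  rw [mul_div_assoc']
  rw [div_le_iff₀ hden]
  have h3 : Real.exp (2 * t * B) * gaussAvg β H (fun a => D.indicator (fun _ => (1 : ℝ)) a * G a) ≤
      Real.exp (2 * t * B) * gaussAvg β H (fun a => sfInd H s a * G a) := mul_le_mul_of_nonneg_left h2 hexp
  have hS0 : 0 ≤ gaussAvg β H (fun a => sfInd H s a * G a) := hE0.trans h2
  have hES : 0 ≤ Real.exp (2 * t * B) * gaussAvg β H (fun a => sfInd H s a * G a) := mul_nonneg hexp hS0
  have h4 : Real.exp (2 * t * B) * gaussAvg β H (fun a => sfInd H s a * G a) ≤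
      2 * Real.exp (2 * t * B) * gaussAvg β H (fun a => sfInd H s a * G a) * gaussAvg β H (D.indicator fun _ => (1 : ℝ)) := by
    have : Real.exp (2 * t * B) * gaussAvg β H (fun a => sfInd H s a * G a) * 1 ≤
        Real.exp (2 * t * B) * gaussAvg β H (fun a => sfInd H s a * G a) * (2 * gaussAvg β H (D.indicator fun _ => (1 : ℝ))) :=
      mul_le_mul_of_nonneg_left (by linarith) hES
    linarith
  exact h3.trans h4

end GaussRestrict

end Summit.QuantumFields.YangMills.Theorems.AllWindowsColdBoxBoxHighLine

end
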